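import Summits.QuantumFields.YangMills.Theorems.FibreConvexityTailOfFirstExitWindowTailL
import Summits.QuantumFields.YangMills.Theorems.FirstExitWindowFirstExitWindowTailLOfFirstExitDeep

/-!
# Crux `TwoSidedTailL` (stmt-QuantumFields-25567, route `FibreConvexityTail`, rung-R3 leaf `YM3TorusSU2`) — SKELETON v4
# (lead seat ym-line-fct-p1 g4): the registry re-pointed to the SHARED deep-exit stub of crux `FirstExitWindowTailL`

WHY v4.  The line «birth» (fibre log-concavity + Herbst; skeletons v1/v2, stub `stub_fibreMGF`) is DEAD for the deep half of the
heights (instrument JOB B, KILL-lean by the pre-registered rule; memo `Lines/birth_dead.md`, lead g2), and `stub_fibreMGF` as registered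
is crux-EQUIVALENT given the landed S2 (`stub_fibreMGF_of_twoSidedTailL`, p620509) — an active registry entry for it would only invite
seats to re-attack the crux under a stub's name.  The one kernel road to the crux that exists in the tree is the lead g2 certificate
`twoSidedTailL_of_firstExitWindowTailL` (p623468: the two-sided event is a SUB-EVENT of the first-exit event of crux
stmt-QuantumFields-26243 at the one-step window's widening) composed with `FirstExitWindow.firstExitWindowTailL_of_firstExitDeep`
(p-landed, width seat sfw-p2-w2 g16: the first averaged level `stub_firstExitOne` is LANDED, p614089, so `FirstExitWindowTailL` is
exactly its deep-exit stub).  v4 therefore registers ONE stub, `stub_firstExitDeep`, with the signature registered on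
stmt-QuantumFields-26243 (and shared verbatim by crux stmt-QuantumFields-22884's skeleton v6) VERBATIM, and `TwoSidedTailL_of` concludes
the crux BY NAME from it.  A `stub-landed` for `stub_firstExitDeep` anywhere closes this crux mechanically (replace the `sorry` by the
landed declaration, submit `--workitem stmt-QuantumFields-25567`); the sibling crux `TowerTailL` (stmt-QuantumFields-25568, residual,
not staffed) closes the same way through `towerTailL_of_firstExitWindowTailL`.

THIS IS A REDUCTION, NOT A LEVER: no new mechanism for the deep exits is proposed here; the stub is the small-field half of Bałaban's
programme in first-exit form (walls and normal forms recorded on stmt-QuantumFields-26243: bounded height landed p622614, `PlainStab`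
road p623013, shift-type walls g24).  STAFFING NOTE: the stub is shared — staff it via stmt-QuantumFields-26243 only.

HONEST SCOPE.  One `sorry` (the shared stub); the crux, the route and rung R3 stay OPEN; R3 is a RECORD rung of the programme, not the
Clay statement, and nothing here bears on the Yang–Mills mass gap.
-/

noncomputable section

open MeasureTheory
open Literature.MathematicalPhysics.QuantumFieldTheory.Balaban1983to89
open Literature.MathematicalPhysics.QuantumFieldTheory.Balaban1983to89.T3ContinuumYM3Torus
open Literature.MathematicalPhysics.QuantumFieldTheory.Balaban1983to89.T3UnitScaleTilt
open Literature.MathematicalPhysics.QuantumFieldTheory.Balaban1983to89.T3UnitLawDensityEML (ℰp)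

namespace Summit.QuantumFields.YangMills.Theorems.FibreConvexityTail

/-- **STUB `stub_firstExitDeep` (SHARED with crux stmt-QuantumFields-26243 `FirstExitWindowTailL` and crux stmt-QuantumFields-22884; the
signature registered there, VERBATIM; OPEN — XL).**  FIRST EXIT AT A DEEP LEVEL `j ≥ 2`: for every block size `L`, profile `(b₀, p₀)` and
widening `b₂ ≥ b₀` there are `γ₁ ∈ (0,1]`, `C ≥ 0`, `c > 0`, `N`, uniform in the family and the coupling, such that for every `F` with
`F.L = L`, `0 < γ ≤ γ₁`, every cut-off `K`, every `2 ≤ j ≤ K` and every level-`j` plaquette `p`: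
`Gibbs_K{every level k < j θ_{b₀}(K−k)-small ∧ Ū^{j} θ_{b₂}(K−j)-small ∧ θ_{b₀}(K−j) ≤ |Ū^{j}(∂p) − 1|} ≤ C·β_{K−j}^N·e^{−c·p(g_{K−j})²}`.
Not attempted here (staffed via stmt-QuantumFields-26243). -/
theorem stub_firstExitDeep :
    open Literature.MathematicalPhysics.QuantumFieldTheory.Balaban1983to89 Literature.MathematicalPhysics.QuantumFieldTheory.Balaban1983to89.T3ContinuumYM3Torus in ∀ (L : ℕ) (b₀ p₀ b₂ : ℝ), 0 < b₀ → 2 < p₀ → b₀ ≤ b₂ → ∃ (γ₁ C c : ℝ) (N : ℕ), 0 < γ₁ ∧ γ₁ ≤ 1 ∧ 0 < c ∧ 0 ≤ C ∧ ∀ (F : T3Family) (γ : ℝ), F.L = L → 0 < γ → γ ≤ γ₁ → ∀ (K j : ℕ), 2 ≤ j → j ≤ K → ∀ p : Plaq (F.P K) j, (T3UnitScaleTilt.gibbsK F T3UnitLawDensityEML.ℰp γ K).real {U | (∀ k, k < j → PlaqSmall (T3UnitScaleTilt.θBal F.L γ b₀ p₀ (K - k)) (Averaging.iter (fun i => BlockAveraging.blockAvg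 (P := F.P K) (j := i) T3UnitLawDensityEML.ℰp) k U)) ∧ PlaqSmall (T3UnitScaleTilt.θBal F.L γ b₂ p₀ (K - j)) (Averaging.iter (fun i => BlockAveraging.blockAvg (P := F.P K) (j := i) T3UnitLawDensityEML.ℰp) j U) ∧ T3UnitScaleTilt.θBal F.L γ b₀ p₀ (K - j) ≤ GaugeGroup.dist1 (GaugeField.plaqHol (Averaging.iter (fun i => BlockAveraging.blockAvg (P := F.P K) (j := i) T3UnitLawDensityEML.ℰp) j U) p)} ≤ C * ((γ * ((F.L : ℝ)⁻¹) ^ (K - j))⁻¹) ^ N * Real.exp (-(c * B10.pFun b₀ p₀ (Real.sqrt (γ * ((F.L : ℝ)⁻¹) ^ (K - j))) ^ 2)) := by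
  sorry

/-- **COMPOSITION `TwoSidedTailL_of`** — the crux `TwoSidedTailL` BY NAME from the shared stub: `stub_firstExitDeep` gives
`FirstExitWindowTailL` (`FirstExitWindow.firstExitWindowTailL_of_firstExitDeep`, merging with the landed first-level exit
`stub_firstExitOne`), and the two-sided event is a sub-event of the first-exit event (`twoSidedTailL_of_firstExitWindowTailL`, p623468).
Kernel-checked modulo the one `sorry`. -/
theorem TwoSidedTailL_of : Summit.QuantumFields.YangMills.Theses.FibreConvexityTail.TwoSidedTailL :=
  twoSidedTailL_of_firstExitWindowTailL (FirstExitWindow.firstExitWindowTailL_of_firstExitDeep stub_firstExitDeep)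

end Summit.QuantumFields.YangMills.Theorems.FibreConvexityTail

end
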